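import Literature.RingTheory.AdicTopology.AdicTowerKernel
import Mathlib.RingTheory.Filtration
import HarnessLib

/-!
# Artin–Rees bounds for the kernel of a morphism from a formal tower ("tricky lemma", algebra)

The Stacks Project, Tag 088A (Cohomology of Schemes, Lemma 30.27.3 — the "tricky lemma" in the
proof of Grothendieck's existence theorem) and Görtz–Wedhorn, *Algebraic Geometry II* (2023),
Prop. 24.91 / Rem. 24.92: on an affine open `Spec B` of a noetherian scheme, a coherent formal
module `(𝓕_n)` along `V(I)` is the finite `B̂`-module `M' = lim 𝓕_n(V)`
(`AdicTowerCompletedLimit`), and all "uniform shift" statements about it come from the Artin–Rees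
lemma over the noetherian ring `B̂` (Stacks 0316 / Mathlib `Ideal.exists_pow_inf_eq_pow_smul`).
This file provides the algebraic input of the single-`e` form of the tricky lemma used in the tree
(`Literature.AlgebraicGeometry.Morphisms.FormalModuleTricky`): for towers `s : P_{n+1} → P_n`
(surjective, `ker = Iⁿ⁺¹P_{n+1}`, `P_0` finite) and `t : N_{n+1} → N_n` (`ker ⊆ Iⁿ⁺¹N_{n+1}`) of
`B/Iⁿ⁺¹`-modules and compatible levelwise SURJECTIVE maps `u_n : P_n → N_n` whose kernels are
killed by a power `K^d` of an ideal `K`,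

* `iter`, `iter_proj`, `u_iter` — iterated transitions `P_m → P_n`;
* `kerLimit` — the `B̂`-submodule `T = {x ∈ lim P_n | u_n(x_n) = 0 ∀ n}` of `M' = lim P_n`,
  `pow_map_smul_kerLimit_eq_bot` (`K^d T = 0`), and
  `exists_mem_kerLimit_proj_eq` (**`T → ker u_m` is surjective**, by successive lifting,
  `AdicTowerKernel.exists_ker_lift`);
* `exists_forall_mem_pow_smul_of_mem_of_apply_eq_zero` — **the main bound**: there is `e₀` such that
  for every `e ≥ e₀` there is `c₀` such that for all `c ≥ c₀`, `n`, and `x ∈ KᵉP_{c+n}` with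
  `u_{c+n}(x) = 0`, one has `x ∈ Iⁿ⁺¹P_{c+n}` (i.e. `x` dies in `P_n`). Proof: Artin–Rees for
  `T ⊆ M'` and the ideal `KB̂` gives `KᵉM' ∩ T = 0` for `e ≥ e₀`; Artin–Rees for the image of `T`
  in `M'/KᵉM'` and the ideal `IB̂` gives the shift `c₀`.

Everything is proved; no named facts.

## References

* The Stacks Project, Tag 088A (Lemma 30.27.3), Tag 00IN (Artin–Rees). [StacksProject]
* U. Görtz, T. Wedhorn, *Algebraic Geometry II: Cohomology of Schemes*, Springer Spektrum (2023),
  Prop. 24.91, Rem. 24.92 (p. 565). [GortzWedhorn2023]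
-/

noncomputable section

universe u v w

open Function

namespace Literature.RingTheory.AdicTopology

open AdicCompletion

variable {B : Type u} [CommRing B] (I : Ideal B)
  {P : ℕ → Type v} [∀ n, AddCommGroup (P n)] [∀ n, Module B (P n)]
  [∀ n, Module (B ⧸ I ^ (n + 1)) (P n)] [∀ n, IsScalarTower B (B ⧸ I ^ (n + 1)) (P n)]
  {N : ℕ → Type w} [∀ n, AddCommGroup (N n)] [∀ n, Module B (N n)]
  (s : ∀ n, P (n + 1) →ₗ[B] P n) (t : ∀ n, N (n + 1) →ₗ[B] N n)
  (u : ∀ n, P n →ₗ[B] N n)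

/-! ### Iterated transition maps -/

section Iter

omit I

/-- **The iterated transition map `P_m → P_n`** (`n ≤ m`). [folklore] -/
def iter {n m : ℕ} (h : n ≤ m) : P m →ₗ[B] P n :=
  Nat.leRec (motive := fun m _ => P m →ₗ[B] P n) LinearMap.id (fun k _ g => g ∘ₗ s k) h

omit [∀ n, Module (B ⧸ I ^ (n + 1)) (P n)] [∀ n, IsScalarTower B (B ⧸ I ^ (n + 1)) (P n)] in
/-- `iter` at `n ≤ n` is the identity. [folklore] -/
@[simp]
theorem iter_self (n : ℕ) : iter s (le_refl n) = LinearMap.id :=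
  Nat.leRec_self _ _

omit [∀ n, Module (B ⧸ I ^ (n + 1)) (P n)] [∀ n, IsScalarTower B (B ⧸ I ^ (n + 1)) (P n)] in
/-- `iter` one step further up is `iter ∘ s`. [folklore] -/
theorem iter_succ {n m : ℕ} (h : n ≤ m) : iter s (Nat.le_succ_of_le h) = iter s h ∘ₗ s m :=
  Nat.leRec_succ _ _ h

omit [∀ n, Module (B ⧸ I ^ (n + 1)) (P n)] [∀ n, IsScalarTower B (B ⧸ I ^ (n + 1)) (P n)] in
/-- `iter` one step further up, on elements. [folklore] -/
theorem iter_succ_apply {n m : ℕ} (h : n ≤ m) (x : P (m + 1)) :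
    iter s (Nat.le_succ_of_le h) x = iter s h (s m x) := by
  rw [iter_succ]; rfl

omit [∀ n, Module (B ⧸ I ^ (n + 1)) (P n)] [∀ n, IsScalarTower B (B ⧸ I ^ (n + 1)) (P n)] in
/-- Peeling off the bottom step: `s n ∘ iter (n+1 ≤ m) = iter (n ≤ m)`. [folklore] -/
theorem s_iter_apply {n m : ℕ} (h : n + 1 ≤ m) (x : P m) :
    s n (iter s h x) = iter s (Nat.le_of_succ_le h) x := by
  induction m, h using Nat.le_induction with
  | base =>
    rw [iter_self, LinearMap.id_apply,
      show (Nat.le_of_succ_le (le_refl (n + 1)) : n ≤ n + 1) = Nat.le_succ_of_le (le_refl n) from rfl,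
      iter_succ_apply s (le_refl n), iter_self, LinearMap.id_apply]
  | succ m hnm ih =>
    rw [iter_succ_apply s hnm, ih,
      show (Nat.le_of_succ_le (Nat.le_succ_of_le hnm) : n ≤ m + 1) =
        Nat.le_succ_of_le (Nat.le_of_succ_le hnm) from rfl, iter_succ_apply s]

omit [∀ n, Module (B ⧸ I ^ (n + 1)) (P n)] [∀ n, IsScalarTower B (B ⧸ I ^ (n + 1)) (P n)] in
/-- **Compatibility of `u` with the iterated transitions**: `u_n (iter s x) = iter t (u_m x)`. [folklore] -/
theorem u_iter (hu : ∀ n, t n ∘ₗ u (n + 1) = u n ∘ₗ s n) {n m : ℕ} (h : n ≤ m) (x : P m) :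
    u n (iter s h x) = iter t h (u m x) := by
  induction m, h using Nat.le_induction with
  | base => rw [iter_self, iter_self]; rfl
  | succ m hnm ih => rw [iter_succ_apply s hnm, iter_succ_apply t hnm, ih, ← transition_u s t u hu]

end Iter

/-- **The projections of the limit are compatible with the iterated transitions**:
`iter s (proj m x) = proj n x`. [folklore] -/
theorem iter_proj {n m : ℕ} (h : n ≤ m) (x : CompletedLimit I s) :
    iter s h (CompletedLimit.proj I s m x) = CompletedLimit.proj I s n x := by
  induction m, h using Nat.le_induction with
  | base => rw [iter_self]; rfl
  | succ m hnm ih => rw [iter_succ_apply s hnm, CompletedLimit.transition_proj, ih]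

/-! ### The kernel submodule `T ⊆ lim P_n` -/

section LevelInstances

attribute [local instance] levelModule

/-- On a level, `evalₐ r • p = b • p` for any `b ∈ B` lifting `evalₐ (n+1) r`. [folklore] -/
theorem exists_smul_level_eq (n : ℕ) (r : AdicCompletion I B) :
    ∃ b : B, ∀ p : P n, (evalₐ I (n + 1) r) • p = b • p := by
  obtain ⟨b, hb⟩ := Ideal.Quotient.mk_surjective (evalₐ I (n + 1) r)
  exact ⟨b, fun p => by rw [← hb, mk_smul_level]⟩

/-- **The kernel submodule `T = {x ∈ lim P_n | u_n (x_n) = 0 for all n}`**, a `B̂`-submodule of the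
finite `B̂`-module `lim P_n`. [cite: StacksProject, Tag 088A] -/
def kerLimit : Submodule (AdicCompletion I B) (CompletedLimit I s) where
  carrier := {x | ∀ n, u n (CompletedLimit.proj I s n x) = 0}
  zero_mem' n := by rw [_root_.map_zero, _root_.map_zero]
  add_mem' {x y} hx hy n := by rw [map_add, map_add, hx n, hy n, add_zero]
  smul_mem' r x hx n := by
    obtain ⟨b, hb⟩ := exists_smul_level_eq I (P := P) n r
    rw [CompletedLimit.proj_smul, hb, map_smul, hx n, smul_zero]

/-- Membership in `kerLimit`. [folklore] -/
theorem mem_kerLimit_iff (x : CompletedLimit I s) :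
    x ∈ kerLimit I s u ↔ ∀ n, u n (CompletedLimit.proj I s n x) = 0 := Iff.rfl

end LevelInstances

/-- **`Kᵈ` kills `T`** if `Kᵈ` kills every `ker u_n`: `(KB̂)ᵈ • T = 0`. [cite: StacksProject, Tag 088A] -/
theorem pow_map_smul_kerLimit_eq_bot {K : Ideal B} {d : ℕ}
    (hK : ∀ n, ∀ k ∈ K ^ d, ∀ x : P n, u n x = 0 → k • x = 0) :
    (K.map (algebraMap B (AdicCompletion I B))) ^ d • kerLimit I s u = ⊥ := by
  rw [eq_bot_iff, ← Ideal.map_pow]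
  refine Submodule.smul_le.mpr fun r hr x hx => ?_
  rw [Submodule.mem_bot]
  induction hr using Submodule.span_induction with
  | mem r hr =>
    obtain ⟨k, hk, rfl⟩ := hr
    rw [algebraMap_smul]
    refine CompletedLimit.ext fun n => ?_
    change CompletedLimit.proj I s n (k • x) = CompletedLimit.proj I s n 0
    rw [map_smul, _root_.map_zero]
    exact hK n k hk _ (hx n)
  | zero => rw [zero_smul]
  | add r r' _ _ h h' => rw [add_smul, h, h', add_zero]
  | smul c r _ h => rw [smul_eq_mul, mul_smul, h, smul_zero]

/-- **`T → ker u_m` is surjective**: an element of `ker u_m` is the `m`-th component of an element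
of `T` (lift successively through the surjective maps `ker u_{k+1} → ker u_k`,
`AdicTowerKernel.exists_ker_lift`; below `m` take the iterated images).
[cite: StacksProject, Tag 088A] [cite: GortzWedhorn2023, Rem. 24.92 (p. 565)] -/
theorem exists_mem_kerLimit_proj_eq (hu : ∀ n, t n ∘ₗ u (n + 1) = u n ∘ₗ s n)
    (hs : ∀ n, Surjective (s n)) (hsurj : ∀ n, Surjective (u n))
    (hkert : ∀ n, LinearMap.ker (t n) ≤ I ^ (n + 1) • ⊤) (m : ℕ) (k : P m) (hk : u m k = 0) :
    ∃ τ ∈ kerLimit I s u, CompletedLimit.proj I s m τ = k := by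
  classical
  -- good elements at level `n`: in `ker u_n`, and equal to the iterate of `k` when `n ≤ m`
  let good : ∀ n, Type v := fun n => {p : P n // u n p = 0 ∧ ∀ h : n ≤ m, p = iter s h k}
  have hk_iter : ∀ {n} (h : n ≤ m), u n (iter s h k) = 0 := fun h => by
    rw [u_iter s t u hu h, hk, _root_.map_zero]
  have step : ∀ n (q : good n), ∃ q' : good (n + 1), s n q'.1 = q.1 := by
    intro n q
    by_cases h : n + 1 ≤ m
    · refine ⟨⟨iter s h k, hk_iter h, fun _ => rfl⟩, ?_⟩
      change s n (iter s h k) = q.1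
      rw [q.2.2 (Nat.le_of_succ_le h), s_iter_apply]
    · obtain ⟨k', hk'u, hk's⟩ := exists_ker_lift I s t u hu hs hsurj hkert n q.1 q.2.1
      exact ⟨⟨k', hk'u, fun h' => absurd h' h⟩, hk's⟩
  choose next hnext using step
  let y : ∀ n, good n := fun n =>
    Nat.rec ⟨iter s (Nat.zero_le m) k, hk_iter _, fun _ => rfl⟩ (fun n q => next n q) n
  refine ⟨CompletedLimit.mk I s (fun n => (y n).1) fun n => hnext n (y n), fun n => ?_, ?_⟩
  · rw [CompletedLimit.proj_apply, CompletedLimit.val_mk]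
    exact (y n).2.1
  · rw [CompletedLimit.proj_apply, CompletedLimit.val_mk, (y m).2.2 le_rfl, iter_self]
    rfl

/-- An element of `KᵉP_n` lifts to an element of `(KB̂)ᵉ(lim P_n)`. [folklore] -/
theorem exists_mem_pow_map_smul_top_proj_eq (hI : I.FG) (hs : ∀ n, Surjective (s n))
    (hkers : ∀ n, LinearMap.ker (s n) ≤ I ^ (n + 1) • ⊤) [Module.Finite B (P 0)]
    (K : Ideal B) (e n : ℕ) (x : P n) (hx : x ∈ K ^ e • (⊤ : Submodule B (P n))) :
    ∃ y ∈ (K.map (algebraMap B (AdicCompletion I B))) ^ e •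
        (⊤ : Submodule (AdicCompletion I B) (CompletedLimit I s)),
      CompletedLimit.proj I s n y = x := by
  refine Submodule.smul_induction_on hx (fun k hk p _ => ?_) ?_
  · obtain ⟨y, rfl⟩ := CompletedLimit.proj_surjective I s hI hs hkers n p
    refine ⟨algebraMap B (AdicCompletion I B) k • y, ?_, by rw [algebraMap_smul, map_smul]⟩
    rw [← Ideal.map_pow]
    exact Submodule.smul_mem_smul (Ideal.mem_map_of_mem _ hk) trivial
  · rintro x y ⟨x', hx', rfl⟩ ⟨y', hy', rfl⟩
    exact ⟨x' + y', Submodule.add_mem _ hx' hy', map_add _ _ _⟩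

/-- Elements of `(IB̂)ᵏ(lim P_n)` project into `IᵏP_n`. [folklore] -/
theorem proj_mem_pow_smul_top_of_mem {k n : ℕ} {y : CompletedLimit I s}
    (hy : y ∈ (I.map (algebraMap B (AdicCompletion I B))) ^ k •
      (⊤ : Submodule (AdicCompletion I B) (CompletedLimit I s))) :
    CompletedLimit.proj I s n y ∈ I ^ k • (⊤ : Submodule B (P n)) := by
  rw [← Ideal.map_pow] at hy
  refine Submodule.smul_induction_on hy (fun r hr z _ => ?_) (fun x y hx hy => ?_)
  · induction hr using Submodule.span_induction generalizing z with
    | mem r hr =>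
      obtain ⟨b, hb, rfl⟩ := hr
      rw [algebraMap_smul, map_smul]
      exact Submodule.smul_mem_smul hb trivial
    | zero => rw [zero_smul, _root_.map_zero]; exact Submodule.zero_mem _
    | add r r' _ _ h h' => rw [add_smul, map_add]; exact Submodule.add_mem _ (h z trivial) (h' z trivial)
    | smul c r _ h => rw [smul_eq_mul, mul_comm, mul_smul]; exact h (c • z) trivial
  · rw [map_add]; exact Submodule.add_mem _ hx hy

/-- `IᵏM'` (for the `B`-action) lies in `(IB̂)ᵏM'`. [folklore] -/
theorem pow_smul_top_le_restrictScalars (k : ℕ) :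
    (I ^ k • (⊤ : Submodule B (CompletedLimit I s))) ≤
      (((I.map (algebraMap B (AdicCompletion I B))) ^ k •
        (⊤ : Submodule (AdicCompletion I B) (CompletedLimit I s))).restrictScalars B) := by
  refine Submodule.smul_le.mpr fun b hb y _ => ?_
  change b • y ∈ (I.map (algebraMap B (AdicCompletion I B))) ^ k •
    (⊤ : Submodule (AdicCompletion I B) (CompletedLimit I s))
  rw [← algebraMap_smul (AdicCompletion I B) b y, ← Ideal.map_pow]
  exact Submodule.smul_mem_smul (Ideal.mem_map_of_mem _ hb) trivial

/-- **The main Artin–Rees bound** (algebraic heart of the tricky lemma). For towers `s`, `t` of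
`B/Iⁿ⁺¹`-modules over a noetherian `B` (`s` surjective with `ker sₙ ⊆ Iⁿ⁺¹P_{n+1}`, `P_0` finite,
`ker tₙ ⊆ Iⁿ⁺¹N_{n+1}`) and compatible levelwise surjective `uₙ : Pₙ → Nₙ` whose kernels are killed
by `Kᵈ`, there is `e₀` such that for every `e ≥ e₀` there is `c₀` such that for all `c ≥ c₀` and `n`:
**an element `x ∈ KᵉP_{c+n}` with `u_{c+n}(x) = 0` lies in `Iⁿ⁺¹P_{c+n}`**.
[cite: StacksProject, Tag 088A] [cite: StacksProject, Tag 00IN] -/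
theorem exists_forall_mem_pow_smul_of_mem_of_apply_eq_zero [IsNoetherianRing B]
    (hu : ∀ n, t n ∘ₗ u (n + 1) = u n ∘ₗ s n) (hI : I.FG) (hs : ∀ n, Surjective (s n))
    (hkers : ∀ n, LinearMap.ker (s n) ≤ I ^ (n + 1) • ⊤) [Module.Finite B (P 0)]
    (hsurj : ∀ n, Surjective (u n)) (hkert : ∀ n, LinearMap.ker (t n) ≤ I ^ (n + 1) • ⊤)
    {K : Ideal B} {d : ℕ} (hK : ∀ n, ∀ k ∈ K ^ d, ∀ x : P n, u n x = 0 → k • x = 0) :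
    ∃ e₀ : ℕ, ∀ e, e₀ ≤ e → ∃ c₀ : ℕ, ∀ c, c₀ ≤ c → ∀ (n : ℕ) (x : P (c + n)),
      x ∈ K ^ e • (⊤ : Submodule B (P (c + n))) → u (c + n) x = 0 →
        x ∈ I ^ (n + 1) • (⊤ : Submodule B (P (c + n))) := by
  -- the noetherian ring `B̂`, the finite module `M' = lim P_n`, the submodule `T`
  set Bh := AdicCompletion I B
  haveI : IsNoetherianRing Bh := Literature.AlgebraicGeometry.Resolution.Stacks0316 B I
  haveI : Module.Finite Bh (CompletedLimit I s) := CompletedLimit.finite I s hI hs hkers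
  set K' : Ideal Bh := K.map (algebraMap B Bh) with hK'
  set I' : Ideal Bh := I.map (algebraMap B Bh) with hI'
  set T : Submodule Bh (CompletedLimit I s) := kerLimit I s u with hT
  have hKT : K' ^ d • T = ⊥ := pow_map_smul_kerLimit_eq_bot I s u hK
  -- Artin–Rees #1: `K'ᵉM' ∩ T = 0` for `e ≥ c' + d`
  obtain ⟨c', hc'⟩ := Ideal.exists_pow_inf_eq_pow_smul K' T
  refine ⟨c' + d, fun e he => ?_⟩
  have hbot : K' ^ e • ⊤ ⊓ T = ⊥ := by
    rw [hc' e (by omega), eq_bot_iff]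
    calc K' ^ (e - c') • (K' ^ c' • ⊤ ⊓ T) ≤ K' ^ (e - c') • T := smul_mono_right _ inf_le_right
      _ ≤ K' ^ d • T := Submodule.smul_mono_left (Ideal.pow_le_pow_right (by omega))
      _ = ⊥ := hKT
  -- Artin–Rees #2 in `M'' = M'/K'ᵉM'` for the image `T''` of `T` and the ideal `I'`
  set W : Submodule Bh (CompletedLimit I s) := K' ^ e • ⊤ with hW
  set T'' : Submodule Bh (CompletedLimit I s ⧸ W) := T.map W.mkQ with hT''
  obtain ⟨c'', hc''⟩ := Ideal.exists_pow_inf_eq_pow_smul I' T''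
  refine ⟨c'', fun c hc n x hxK hux => ?_⟩
  -- lift `x` into `K'ᵉM'` and into `T`
  obtain ⟨y₀, hy₀, hy₀x⟩ := exists_mem_pow_map_smul_top_proj_eq I s hI hs hkers K e (c + n) x hxK
  obtain ⟨τ, hτT, hτx⟩ := exists_mem_kerLimit_proj_eq I s t u hu hs hsurj hkert (c + n) x hux
  -- `τ - y₀ ∈ ker proj_{c+n} = I^{c+n+1} M'`
  have hdiff : τ - y₀ ∈ ((I' ^ (c + n + 1) • (⊤ : Submodule Bh (CompletedLimit I s))).restrictScalars B) := by
    apply pow_smul_top_le_restrictScalars I s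
    rw [← CompletedLimit.ker_proj I s hI hs hkers (c + n), LinearMap.mem_ker, map_sub, hτx, hy₀x,
      sub_self]
  -- hence the image of `τ` in `M''` lies in `I'^{c+n+1} M'' ∩ T''`
  have hmkτ : W.mkQ τ ∈ I' ^ (c + n + 1) • (⊤ : Submodule Bh (CompletedLimit I s ⧸ W)) ⊓ T'' := by
    refine ⟨?_, ⟨τ, hτT, rfl⟩⟩
    have hy₀W : W.mkQ y₀ = 0 := by
      rw [Submodule.mkQ_apply, Submodule.Quotient.mk_eq_zero]; exact hy₀
    rw [show W.mkQ τ = W.mkQ (τ - y₀) by rw [map_sub, hy₀W, sub_zero], ← Submodule.range_mkQ W,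
      ← Submodule.map_top, ← Submodule.map_smul'']
    exact ⟨τ - y₀, hdiff, rfl⟩
  rw [hc'' (c + n + 1) (by omega)] at hmkτ
  have hmkτ' : W.mkQ τ ∈ (I' ^ (c + n + 1 - c'') • T).map W.mkQ := by
    rw [Submodule.map_smul'']
    exact (smul_mono_right _ inf_le_right :
      I' ^ (c + n + 1 - c'') • (I' ^ c'' • ⊤ ⊓ T'') ≤ I' ^ (c + n + 1 - c'') • T'') hmkτ
  obtain ⟨σ, hσ, hστ⟩ := hmkτ'
  -- `τ - σ ∈ K'ᵉM' ∩ T = 0`, so `τ = σ ∈ I'^{c+n+1-c''} T ⊆ I'^{n+1} M'`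
  have hσT : σ ∈ T := Submodule.smul_le_right hσ
  have hτσ : τ - σ ∈ K' ^ e • ⊤ ⊓ T := by
    refine ⟨?_, Submodule.sub_mem _ hτT hσT⟩
    change τ - σ ∈ W
    rw [← Submodule.ker_mkQ W, LinearMap.mem_ker, map_sub, hστ, sub_self]
  rw [hbot, Submodule.mem_bot, sub_eq_zero] at hτσ
  have hτI : τ ∈ I' ^ (n + 1) • (⊤ : Submodule Bh (CompletedLimit I s)) := by
    rw [hτσ]
    exact Submodule.smul_mono (Ideal.pow_le_pow_right (by omega)) le_top hσ
  -- and `y₀ = τ - (τ - y₀) ∈ I'^{n+1} M'`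
  have hy₀I : y₀ ∈ I' ^ (n + 1) • (⊤ : Submodule Bh (CompletedLimit I s)) := by
    have h2 : τ - y₀ ∈ I' ^ (n + 1) • (⊤ : Submodule Bh (CompletedLimit I s)) :=
      Submodule.smul_mono (Ideal.pow_le_pow_right (by omega)) le_rfl hdiff
    have := Submodule.sub_mem _ hτI h2
    rwa [sub_sub_cancel] at this
  rw [← hy₀x]
  exact proj_mem_pow_smul_top_of_mem I s hy₀I

end Literature.RingTheory.AdicTopology

end
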